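/-
COR-CM (cell pub-hodgecm2) — THE HECKE OPERATORS ON `H¹(X_Γ(ℂ); ℚ)` ARE FUNCTIONS ON DOUBLE COSETS (`T_{δ₁γδ₂} = T_γ`,
`δᵢ ∈ Γ`), AND THE OPERATOR OF A SYMMETRIC DOUBLE COSET (`Γγ⁻¹Γ = ΓγΓ`) IS SEMISIMPLE WITH NO COMMUTATIVITY INPUT.
Lane «L-BYPASS LEAVES» (b10 gen 22): kernel text by the seat pub-hodgecm2-s2crux-idea-2 (probe RA-v34 Parts L–M, gen 8; the
(ℓ)/(t)-free packaging over `HeckeAlgebraSemisimple` by b10); filed by b10.  Count-neutral: no BINDER-OWNERS row, nothing under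
`B01/Transposition`, Interfaces (C1) / E term untouched.  HC_CM is NOT proved; B01-S is NOT discharged; this file inhabits no
binder of the END display.
-/
import Summits.HodgeConjecture.CorCM.Geometry.HeckeAlgebraSemisimple
import HarnessLib

set_option autoImplicit false

/-!
# Hecke operators on `H¹(X_Γ(ℂ); ℚ)`: double-coset invariance, and semisimplicity on symmetric double cosets

`X_Γ = Var.scheme hU h₃ (.pms (pmsCode L ι₁ V Γ))`; `T_γ = τ'_{f₁} ∘ g^*` for the Hecke pair over `Γ_γ = Γ ∩ γ⁻¹Γγ`
(`HeckeOperatorSemisimple`, `HeckeAlgebraSemisimple`).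

* §1 `Level.map_conj_heckePair_Γ_le_heckePair_of_mem` — `δ₂ Γ_{δ₁γδ₂} δ₂⁻¹ ≤ Γ_γ` for `δ₁, δ₂ ∈ Γ`: the translate
  `X_{Γ_{δ₁γδ₂}} → X_{Γ_γ}`, `[w] ↦ [δ₂ w]`, exists.
* §2 `Model.unif_map_mulVec_of_mem` (the uniformisation `unif_Γ` is `Γ`-invariant), `mapContinuous_eq_comp_of_unif''`, and
  `Model.transferMap_comp_pull_eq_of_mem_of_mem` — **`T_{δ₁γδ₂} = T_γ`**: the translate `t` over `w ↦ δ₂ w` satisfies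
  `f₁' = f₁ ∘ t`, `g' = g ∘ t` on complex points, and `τ'_{f₁∘t} ∘ (g∘t)^* = τ'_{f₁} ∘ g^*` (`FiniteCoverTransferSwap`) — the
  Hecke operators are indexed by `Γ \ U(V)(L) / Γ` (first half of the labelling sentence of the Hecke–Hodge dictionary).
* §3 `Model.exists_heckeAlgebra_isSemisimple_biInvariant` — the family theorem of `HeckeAlgebraSemisimple` with the clause
  `T_{δ₁γδ₂} = T_γ` added; `Model.exists_heckeOperator_isSemisimple_of_inv_mem_doubleCoset` — **if `γ⁻¹ = δ₁γδ₂` with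
  `δᵢ ∈ Γ` (a SYMMETRIC double coset) then `T_γ` is a semisimple endomorphism of `H¹(X_Γ(ℂ); ℚ)`** with NO commutativity
  hypothesis: `ᵗT_γ = T_{γ⁻¹} = T_γ`, so `{T_γ}` is an adjoint-stable commuting family.  Inputs: the level, anisotropy,
  `γ`, the symmetry; `hHD`/`hI` are the tree-discharged model-choice facts.

References: G. Shimura, *Introduction to the Arithmetic Theory of Automorphic Functions* (1971), §3.1 Prop. 3.1, §3.2–3.4,
§7.2–7.3 [Shimura1971]; N. Bergeron, J. Millson, C. Moeglin, Acta Math. 216 (2016), Introduction §1.1, Part 2 §1.3, §1.8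
[BergeronMillsonMoeglin2016Balls]; A. Hatcher, *Algebraic Topology* (2002), §3.G [HatcherAT2002]; H. Lange, *Abelian Varieties
over the Complex Numbers* (2023), §2.4.1 Thm. 2.4.9 [Lange2023AbelianVarietiesC]; C. Voisin, *Hodge Theory and Complex Algebraic
Geometry I* (2002), §7.1.2, §7.3.2 [VoisinHodgeI2002].
-/

noncomputable section

open CategoryTheory Matrix
open Literature.AlgebraicGeometry.Motives (SchemeOver ComplexPoints AlgPoints bettiCohomology)
open Literature.AlgebraicGeometry.HodgeTheory
open Literature.AlgebraicGeometry.ShimuraVarieties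
open Literature.AlgebraicTopology.SingularHomology

namespace Summit.HodgeConjecture.CorCM

open NumberField Literature.NumberTheory.Automorphic

/-! ## §1 The translate between the Hecke levels of `δ₁γδ₂` and `γ` -/

namespace Level

variable {L : CMField} {ι₁ : L →+* ℂ} {V : HermSpace3 L ι₁}

/-- `δ₂ (Γ ∩ (δ₁γδ₂)⁻¹ Γ (δ₁γδ₂)) δ₂⁻¹ ≤ Γ ∩ γ⁻¹ Γ γ` for `δ₁, δ₂ ∈ Γ` — the level hypothesis of the translate
`X_{Γ_{δ₁γδ₂}} ⟶ X_{Γ_γ}`, `[w] ↦ [δ₂ w]`. [cite: Shimura1971, §3.1 Prop. 3.1] -/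
theorem map_conj_heckePair_Γ_le_heckePair_of_mem (Γ : Level V) {γ δ₁ δ₂ : GL (Fin 3) L}
    (hγ : γ ∈ unitaryGroup (cmConjRingHom L) V.Hm) (hδ₁ : δ₁ ∈ Γ.Γ) (hδ₂ : δ₂ ∈ Γ.Γ)
    (hγ' : δ₁ * γ * δ₂ ∈ unitaryGroup (cmConjRingHom L) V.Hm) :
    (Γ.heckePair (δ₁ * γ * δ₂) hγ').Γ.map (MulAut.conj δ₂).toMonoidHom ≤ (Γ.heckePair γ hγ).Γ := by
  rintro _ ⟨δ, hδ, rfl⟩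
  have hδΓ : δ ∈ Γ.Γ := (Subgroup.mem_inf.mp hδ).1
  have h0 := Γ.conj_mem_of_mem_heckePair hγ' hδ
  have hy : γ * (δ₂ * δ * δ₂⁻¹) * γ⁻¹ ∈ Γ.Γ := by
    have h1 := Γ.Γ.mul_mem (Γ.Γ.mul_mem (Γ.Γ.inv_mem hδ₁) h0) hδ₁
    have key : γ * (δ₂ * δ * δ₂⁻¹) * γ⁻¹ = δ₁⁻¹ * (δ₁ * γ * δ₂ * δ * (δ₁ * γ * δ₂)⁻¹) * δ₁ := by group
    rw [key]
    exact h1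
  refine Subgroup.mem_inf.mpr ⟨?_, Subgroup.mem_map.mpr ⟨γ * (δ₂ * δ * δ₂⁻¹) * γ⁻¹, hy, ?_⟩⟩
  · simpa [MulAut.conj_apply] using Γ.Γ.mul_mem (Γ.Γ.mul_mem hδ₂ hδΓ) (Γ.Γ.inv_mem hδ₂)
  · simp only [MulEquiv.coe_toMonoidHom, MulAut.conj_apply]
    group

end Level

/-! ## §2 Double-coset invariance `T_{δ₁γδ₂} = T_γ` -/

namespace Model

open Literature.NumberTheory.Automorphic.PicardCM

section DoubleCoset

variable {hU : BallQuotientUniformisedDatum} {h₃ : CMAbelianVarietyRealised}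
variable {L : CMField} {ι₁ : L →+* ℂ} {V : HermSpace3 L ι₁}

/-- The uniformised cones of two realising levels coincide (same complex Gram matrix `H^{ι₁}`).
[cite: BergeronMillsonMoeglin2016Balls, Part 2 §1.3] -/
theorem mem_cone_of_level {Γ₁ Γ₂ : Level V} (h₁ : (pmsCode L ι₁ V Γ₁).IsAnisotropic)
    (h₂ : (pmsCode L ι₁ V Γ₂).IsAnisotropic) {v : Fin 3 → ℂ}
    (hv : v ∈ (Var.ballDatum hU h₃ (pmsCode L ι₁ V Γ₁) h₁).cone) :
    v ∈ (Var.ballDatum hU h₃ (pmsCode L ι₁ V Γ₂) h₂).cone := by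
  change _ ∈ negCone (Var.ballDatum hU h₃ (pmsCode L ι₁ V Γ₂) h₂).Hℂ
  rw [← ballDatum_Hℂ_eq hU h₃ Γ₂ Γ₁ h₁ h₂]
  exact hv

/-- **The uniformisation is `Γ`-invariant**: `unif_Γ (δ^{ι₁} v) = unif_Γ v` for `δ ∈ Γ` and `v` in the cone
(fibre clause `unif_eq_unif_iff` of the ball datum; its group read in `GL₃(ℂ)` is `ι₁(Γ)`, the tree's
`Model.ballDatum_pmsCode_map_Γ`).
[cite: BergeronMillsonMoeglin2016Balls, Introduction §1.1] -/
theorem unif_map_mulVec_of_mem (Γ : Level V) (h : (pmsCode L ι₁ V Γ).IsAnisotropic) {δ : GL (Fin 3) L}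
    (hδ : δ ∈ Γ.Γ) {v : Fin 3 → ℂ} (hv : v ∈ (Var.ballDatum hU h₃ (pmsCode L ι₁ V Γ) h).cone) :
    (Var.ballDatum hU h₃ (pmsCode L ι₁ V Γ) h).unif (((δ : Matrix (Fin 3) (Fin 3) L).map ι₁) *ᵥ v) =
      (Var.ballDatum hU h₃ (pmsCode L ι₁ V Γ) h).unif v := by
  have hmem : Matrix.GeneralLinearGroup.map ι₁ δ ∈
      (Var.ballDatum hU h₃ (pmsCode L ι₁ V Γ) h).Γ.map
        (Matrix.GeneralLinearGroup.map (Var.ballDatum hU h₃ (pmsCode L ι₁ V Γ) h).τ₁) := by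
    rw [ballDatum_pmsCode_map_Γ hU h₃ Γ h]
    exact Subgroup.mem_map_of_mem _ hδ
  obtain ⟨γD, hγD, hγeq⟩ := Subgroup.mem_map.mp hmem
  have hmat : ((γD : Matrix (Fin 3) (Fin 3) _).map (Var.ballDatum hU h₃ (pmsCode L ι₁ V Γ) h).τ₁) =
      ((δ : Matrix (Fin 3) (Fin 3) L).map ι₁) := by
    ext i j
    have hij := congrArg (fun g : GL (Fin 3) ℂ => (g : Matrix (Fin 3) (Fin 3) ℂ) i j) hγeq
    simpa only [Matrix.GeneralLinearGroup.map_apply, Matrix.map_apply] using hij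
  have hw : ((δ : Matrix (Fin 3) (Fin 3) L).map ι₁) *ᵥ v ∈ (Var.ballDatum hU h₃ (pmsCode L ι₁ V Γ) h).cone :=
    map_mulVec_mem_cone h h (Γ.isCongruence.1 hδ) hv
  symm
  refine ((Var.ballDatum hU h₃ (pmsCode L ι₁ V Γ) h).unif_eq_unif_iff v hv _ hw).2
    ⟨γD, hγD, 1, one_ne_zero, ?_⟩
  rw [one_smul, hmat]

/-- Maps of complex points of realising levels that agree on the uniformised cone agree — twisted form MODULO
`Γ₃`: `F` over `v ↦ a v`, `q` over `v ↦ b v`, `f` over `w ↦ c w`, `b(cone₁) ⊆ cone₂`, and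
`unif₃ (c (b v)) = unif₃ (a v)` on `cone₁` `⇒ F(ℂ) = f(ℂ) ∘ q(ℂ)` (maps are determined on the dense uniformised cone).
[cite: BergeronMillsonMoeglin2016Balls, Part 2 §1.8] -/
theorem mapContinuous_eq_comp_of_unif'' {Γ₁ Γ₂ Γ₃ : Level V} (h₁ : (pmsCode L ι₁ V Γ₁).IsAnisotropic)
    (h₂ : (pmsCode L ι₁ V Γ₂).IsAnisotropic) (h₃' : (pmsCode L ι₁ V Γ₃).IsAnisotropic)
    {F : Var.scheme hU h₃ (.pms (pmsCode L ι₁ V Γ₁)) ⟶ Var.scheme hU h₃ (.pms (pmsCode L ι₁ V Γ₃))}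
    {q : Var.scheme hU h₃ (.pms (pmsCode L ι₁ V Γ₁)) ⟶ Var.scheme hU h₃ (.pms (pmsCode L ι₁ V Γ₂))}
    {f : Var.scheme hU h₃ (.pms (pmsCode L ι₁ V Γ₂)) ⟶ Var.scheme hU h₃ (.pms (pmsCode L ι₁ V Γ₃))}
    {a b c : (Fin 3 → ℂ) → (Fin 3 → ℂ)}
    (hF : ∀ v ∈ (Var.ballDatum hU h₃ (pmsCode L ι₁ V Γ₁) h₁).cone,
      AlgPoints.map F ((Var.ballDatum hU h₃ (pmsCode L ι₁ V Γ₁) h₁).unif v) =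
        (Var.ballDatum hU h₃ (pmsCode L ι₁ V Γ₃) h₃').unif (a v))
    (hq : ∀ v ∈ (Var.ballDatum hU h₃ (pmsCode L ι₁ V Γ₁) h₁).cone,
      AlgPoints.map q ((Var.ballDatum hU h₃ (pmsCode L ι₁ V Γ₁) h₁).unif v) =
        (Var.ballDatum hU h₃ (pmsCode L ι₁ V Γ₂) h₂).unif (b v))
    (hf : ∀ w ∈ (Var.ballDatum hU h₃ (pmsCode L ι₁ V Γ₂) h₂).cone,
      AlgPoints.map f ((Var.ballDatum hU h₃ (pmsCode L ι₁ V Γ₂) h₂).unif w) =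
        (Var.ballDatum hU h₃ (pmsCode L ι₁ V Γ₃) h₃').unif (c w))
    (hb : ∀ v ∈ (Var.ballDatum hU h₃ (pmsCode L ι₁ V Γ₁) h₁).cone,
      b v ∈ (Var.ballDatum hU h₃ (pmsCode L ι₁ V Γ₂) h₂).cone)
    (habc : ∀ v ∈ (Var.ballDatum hU h₃ (pmsCode L ι₁ V Γ₁) h₁).cone,
      (Var.ballDatum hU h₃ (pmsCode L ι₁ V Γ₃) h₃').unif (c (b v)) =
        (Var.ballDatum hU h₃ (pmsCode L ι₁ V Γ₃) h₃').unif (a v)) :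
    AlgPoints.mapContinuous (L := ℂ) F =
      (AlgPoints.mapContinuous (L := ℂ) f).comp (AlgPoints.mapContinuous (L := ℂ) q) := by
  refine ContinuousMap.ext fun P => ?_
  obtain ⟨v, hv, rfl⟩ := (Var.ballDatum hU h₃ (pmsCode L ι₁ V Γ₁) h₁).surjOn_unif (Set.mem_univ P)
  rw [ContinuousMap.comp_apply, AlgPoints.mapContinuous_apply, AlgPoints.mapContinuous_apply,
    AlgPoints.mapContinuous_apply, hF v hv, hq v hv, hf _ (hb v hv), habc v hv]

/-- **Double-coset invariance of the geometric Hecke operator**: for `δ₁, δ₂ ∈ Γ`, Hecke pairs `(f₁, g)` over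
`Γ_γ` (for `γ`) and `(f₁', g')` over `Γ_{δ₁γδ₂}` (for `δ₁ γ δ₂`) give THE SAME operator
`τ'_{f₁'} ∘ g'^* = τ'_{f₁} ∘ g^*` on `Hⁿ(X_Γ(ℂ); ℚ)`: the translate `t : X_{Γ_{δ₁γδ₂}} ⟶ X_{Γ_γ}` over
`w ↦ δ₂^{ι₁} w` (`exists_heckeTranslate_isFiniteCover` over `Level.map_conj_heckePair_Γ_le_heckePair_of_mem`)
satisfies `f₁' = f₁ ∘ t` and `g' = g ∘ t` on complex points (`unif_Γ` is `Γ`-invariant, `unif_map_mulVec_of_mem`),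
and `τ'_{f₁∘t} ∘ (g∘t)^* = τ'_{f₁} ∘ g^*` (`IsFiniteCover.transferMap_comp_map_eq_of_comp`).
[cite: Shimura1971, §3.1 Prop. 3.1 and §7.2–7.3] [cite: HatcherAT2002, §3.G p. 321] -/
theorem transferMap_comp_pull_eq_of_mem_of_mem (hHD : exists_isReal_hodgeModel) (Γ : Level V)
    (h : (pmsCode L ι₁ V Γ).IsAnisotropic) {γ δ₁ δ₂ : GL (Fin 3) L}
    (hγ : γ ∈ unitaryGroup (cmConjRingHom L) V.Hm) (hδ₁ : δ₁ ∈ Γ.Γ) (hδ₂ : δ₂ ∈ Γ.Γ)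
    (hγ' : δ₁ * γ * δ₂ ∈ unitaryGroup (cmConjRingHom L) V.Hm)
    {f₁ g : Var.scheme hU h₃ (.pms (pmsCode L ι₁ V (Γ.heckePair γ hγ))) ⟶ Var.scheme hU h₃ (.pms (pmsCode L ι₁ V Γ))}
    {f₁' g' : Var.scheme hU h₃ (.pms (pmsCode L ι₁ V (Γ.heckePair (δ₁ * γ * δ₂) hγ'))) ⟶
      Var.scheme hU h₃ (.pms (pmsCode L ι₁ V Γ))}
    (cf₁ : IsFiniteCover (AlgPoints.mapContinuous (L := ℂ) f₁))
    (cf₁' : IsFiniteCover (AlgPoints.mapContinuous (L := ℂ) f₁'))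
    (hf₁ : ∀ v ∈ (Var.ballDatum hU h₃ (pmsCode L ι₁ V (Γ.heckePair γ hγ))
        ((isAnisotropic_pmsCode_iff_of_level Γ (Γ.heckePair γ hγ)).2 h)).cone,
      AlgPoints.map f₁ ((Var.ballDatum hU h₃ (pmsCode L ι₁ V (Γ.heckePair γ hγ))
        ((isAnisotropic_pmsCode_iff_of_level Γ (Γ.heckePair γ hγ)).2 h)).unif v) =
        (Var.ballDatum hU h₃ (pmsCode L ι₁ V Γ) h).unif v)
    (hg : ∀ v ∈ (Var.ballDatum hU h₃ (pmsCode L ι₁ V (Γ.heckePair γ hγ))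
        ((isAnisotropic_pmsCode_iff_of_level Γ (Γ.heckePair γ hγ)).2 h)).cone,
      AlgPoints.map g ((Var.ballDatum hU h₃ (pmsCode L ι₁ V (Γ.heckePair γ hγ))
        ((isAnisotropic_pmsCode_iff_of_level Γ (Γ.heckePair γ hγ)).2 h)).unif v) =
        (Var.ballDatum hU h₃ (pmsCode L ι₁ V Γ) h).unif (((γ : Matrix (Fin 3) (Fin 3) L).map ι₁) *ᵥ v))
    (hf₁' : ∀ w ∈ (Var.ballDatum hU h₃ (pmsCode L ι₁ V (Γ.heckePair (δ₁ * γ * δ₂) hγ'))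
        ((isAnisotropic_pmsCode_iff_of_level Γ (Γ.heckePair (δ₁ * γ * δ₂) hγ')).2 h)).cone,
      AlgPoints.map f₁' ((Var.ballDatum hU h₃ (pmsCode L ι₁ V (Γ.heckePair (δ₁ * γ * δ₂) hγ'))
        ((isAnisotropic_pmsCode_iff_of_level Γ (Γ.heckePair (δ₁ * γ * δ₂) hγ')).2 h)).unif w) =
        (Var.ballDatum hU h₃ (pmsCode L ι₁ V Γ) h).unif w)
    (hg' : ∀ w ∈ (Var.ballDatum hU h₃ (pmsCode L ι₁ V (Γ.heckePair (δ₁ * γ * δ₂) hγ'))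
        ((isAnisotropic_pmsCode_iff_of_level Γ (Γ.heckePair (δ₁ * γ * δ₂) hγ')).2 h)).cone,
      AlgPoints.map g' ((Var.ballDatum hU h₃ (pmsCode L ι₁ V (Γ.heckePair (δ₁ * γ * δ₂) hγ'))
        ((isAnisotropic_pmsCode_iff_of_level Γ (Γ.heckePair (δ₁ * γ * δ₂) hγ')).2 h)).unif w) =
        (Var.ballDatum hU h₃ (pmsCode L ι₁ V Γ) h).unif
          ((((δ₁ * γ * δ₂ : GL (Fin 3) L) : Matrix (Fin 3) (Fin 3) L).map ι₁) *ᵥ w))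
    (n : ℕ) :
    (cf₁'.transferMap (R := ℚ) n).hom ∘ₗ BettiUniverse.pull g' n =
      (cf₁.transferMap (R := ℚ) n).hom ∘ₗ BettiUniverse.pull g n := by
  have h₁ := (isAnisotropic_pmsCode_iff_of_level Γ (Γ.heckePair γ hγ)).2 h
  have h₂ := (isAnisotropic_pmsCode_iff_of_level Γ (Γ.heckePair (δ₁ * γ * δ₂) hγ')).2 h
  have hδ₁u : δ₁ ∈ unitaryGroup (cmConjRingHom L) V.Hm := Γ.isCongruence.1 hδ₁
  have hδ₂u : δ₂ ∈ unitaryGroup (cmConjRingHom L) V.Hm := Γ.isCongruence.1 hδ₂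
  -- the translate `t : X_{Γ_{δ₁γδ₂}} → X_{Γ_γ}` over `w ↦ δ₂ w`, a finite covering
  obtain ⟨t, ct, ht⟩ := exists_heckeTranslate_isFiniteCover (hU := hU) (h₃ := h₃) hHD hδ₂u
    (Level.map_conj_heckePair_Γ_le_heckePair_of_mem Γ hγ hδ₁ hδ₂ hγ') h₂ h₁
  haveI := connectedSpace_complexPoints
    (Var.isSmoothProjective hU h₃ (.pms (pmsCode L ι₁ V (Γ.heckePair γ hγ))))
  -- `f₁' = f₁ ∘ t` and `g' = g ∘ t` on complex points
  have hA : AlgPoints.mapContinuous (L := ℂ) f₁' =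
      (AlgPoints.mapContinuous (L := ℂ) f₁).comp (AlgPoints.mapContinuous (L := ℂ) t) :=
    mapContinuous_eq_comp_of_unif'' h₂ h₁ h hf₁' ht hf₁
      (fun w hw => map_mulVec_mem_cone h₂ h₁ hδ₂u hw)
      (fun w hw => unif_map_mulVec_of_mem Γ h hδ₂ (mem_cone_of_level h₂ h hw))
  have hB : AlgPoints.mapContinuous (L := ℂ) g' =
      (AlgPoints.mapContinuous (L := ℂ) g).comp (AlgPoints.mapContinuous (L := ℂ) t) := by
    refine mapContinuous_eq_comp_of_unif'' h₂ h₁ h hg' ht hg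
      (fun w hw => map_mulVec_mem_cone h₂ h₁ hδ₂u hw) (fun w hw => ?_)
    have hx : ((γ : Matrix (Fin 3) (Fin 3) L).map ι₁) *ᵥ (((δ₂ : Matrix (Fin 3) (Fin 3) L).map ι₁) *ᵥ w) ∈
        (Var.ballDatum hU h₃ (pmsCode L ι₁ V Γ) h).cone :=
      map_mulVec_mem_cone h₁ h hγ (map_mulVec_mem_cone h₂ h₁ hδ₂u hw)
    rw [show (((δ₁ * γ * δ₂ : GL (Fin 3) L) : Matrix (Fin 3) (Fin 3) L).map ι₁) *ᵥ w =
        ((δ₁ : Matrix (Fin 3) (Fin 3) L).map ι₁) *ᵥ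
          (((γ : Matrix (Fin 3) (Fin 3) L).map ι₁) *ᵥ (((δ₂ : Matrix (Fin 3) (Fin 3) L).map ι₁) *ᵥ w)) from by
      rw [Units.val_mul, Units.val_mul, Matrix.map_mul, Matrix.map_mul, ← Matrix.mulVec_mulVec,
        ← Matrix.mulVec_mulVec]]
    exact (unif_map_mulVec_of_mem Γ h hδ₁ hx).symm
  exact IsFiniteCover.transferMap_comp_map_eq_of_comp cf₁' cf₁ ct hA hB n

end DoubleCoset

/-! ## §3 The bi-invariant Hecke family; symmetric double cosets -/

section HeckeFamilyBiInvariant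

variable {hU : BallQuotientUniformisedDatum} {h₃ : CMAbelianVarietyRealised}
variable {L : CMField} {ι₁ : L →+* ℂ} {V : HermSpace3 L ι₁}

/-- **The Hecke family is a function on double cosets, its transposes are `T_{γ⁻¹}`, and — given (c) ONLY — it
generates an algebra of semisimple endomorphisms of `H¹(X_Γ(ℂ); ℚ)`.**  As
`exists_heckeAlgebra_isSemisimple_of_inv_mem` (`HeckeAlgebraSemisimple`: (ℓ) and (t) discharged), with the added clause
`T_{δ₁γδ₂} = T_γ` (`δ₁, δ₂ ∈ Γ`; `transferMap_comp_pull_eq_of_mem_of_mem`) — the operators are indexed by `Γ \ U(V)(L) / Γ`.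
[cite: Shimura1971, §3.1 Prop. 3.1, §3.2–3.4 and §7.2–7.3] [cite: Lange2023AbelianVarietiesC, §2.4.1 Thm. 2.4.9]
[cite: VoisinHodgeI2002, §7.1.2 and §7.3.2] [cite: HatcherAT2002, §3.G p. 321] -/
theorem exists_heckeAlgebra_isSemisimple_biInvariant (hHD : exists_isReal_hodgeModel)
    (hI : hodgePQ_independent_of_hodgeModel) (Γ : Level V)
    (h : (pmsCode L ι₁ V Γ).IsAnisotropic) :
    ∃ T T' : ↥(unitaryGroup (cmConjRingHom L) V.Hm) →
        Module.End ℚ (bettiCohomology (Var.scheme hU h₃ (.pms (pmsCode L ι₁ V Γ))) 1),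
      (∀ γ : ↥(unitaryGroup (cmConjRingHom L) V.Hm),
        ∃ (f₁ g : Var.scheme hU h₃ (.pms (pmsCode L ι₁ V (Γ.heckePair (γ : GL (Fin 3) L) γ.2))) ⟶
            Var.scheme hU h₃ (.pms (pmsCode L ι₁ V Γ)))
          (c₁ : IsFiniteCover (AlgPoints.mapContinuous (L := ℂ) f₁))
          (c₂ : IsFiniteCover (AlgPoints.mapContinuous (L := ℂ) g)),
          (∀ v ∈ (Var.ballDatum hU h₃ (pmsCode L ι₁ V (Γ.heckePair (γ : GL (Fin 3) L) γ.2))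
              ((isAnisotropic_pmsCode_iff_of_level Γ (Γ.heckePair (γ : GL (Fin 3) L) γ.2)).2 h)).cone,
            AlgPoints.map f₁ ((Var.ballDatum hU h₃ (pmsCode L ι₁ V (Γ.heckePair (γ : GL (Fin 3) L) γ.2))
              ((isAnisotropic_pmsCode_iff_of_level Γ (Γ.heckePair (γ : GL (Fin 3) L) γ.2)).2 h)).unif v) =
              (Var.ballDatum hU h₃ (pmsCode L ι₁ V Γ) h).unif v) ∧
          (∀ v ∈ (Var.ballDatum hU h₃ (pmsCode L ι₁ V (Γ.heckePair (γ : GL (Fin 3) L) γ.2))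
              ((isAnisotropic_pmsCode_iff_of_level Γ (Γ.heckePair (γ : GL (Fin 3) L) γ.2)).2 h)).cone,
            AlgPoints.map g ((Var.ballDatum hU h₃ (pmsCode L ι₁ V (Γ.heckePair (γ : GL (Fin 3) L) γ.2))
              ((isAnisotropic_pmsCode_iff_of_level Γ (Γ.heckePair (γ : GL (Fin 3) L) γ.2)).2 h)).unif v) =
              (Var.ballDatum hU h₃ (pmsCode L ι₁ V Γ) h).unif
                ((((γ : GL (Fin 3) L) : Matrix (Fin 3) (Fin 3) L).map ι₁) *ᵥ v)) ∧
          T γ = (c₁.transferMap (R := ℚ) 1).hom ∘ₗ BettiUniverse.pull g 1 ∧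
          T' γ = (c₂.transferMap (R := ℚ) 1).hom ∘ₗ BettiUniverse.pull f₁ 1) ∧
      (∀ γ, T γ ∈ (BettiUniverse.hodge hHD (Var.isSmoothProjective hU h₃ (.pms (pmsCode L ι₁ V Γ))) 1).endAlg) ∧
      (∀ γ, T' γ = T γ⁻¹) ∧
      (∀ (γ : ↥(unitaryGroup (cmConjRingHom L) V.Hm)) (δ₁ δ₂ : GL (Fin 3) L) (hδ₁ : δ₁ ∈ Γ.Γ) (hδ₂ : δ₂ ∈ Γ.Γ),
        T ⟨δ₁ * (γ : GL (Fin 3) L) * δ₂,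
            mul_mem (mul_mem (Γ.isCongruence.1 hδ₁) γ.2) (Γ.isCongruence.1 hδ₂)⟩ = T γ) ∧
      ∀ S : Set ↥(unitaryGroup (cmConjRingHom L) V.Hm), (∀ γ ∈ S, γ⁻¹ ∈ S) →
        (∀ γ ∈ S, ∀ δ ∈ S, Commute (T γ) (T δ)) →
        ∀ a ∈ Algebra.adjoin ℚ (Set.range fun δ : S => T δ), Module.End.IsSemisimple a := by
  obtain ⟨T, T', hpair, hT, ht, hfam⟩ :=
    exists_heckeAlgebra_isSemisimple_of_inv_mem (hU := hU) (h₃ := h₃) hHD hI Γ h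
  refine ⟨T, T', hpair, hT, ht, fun γ δ₁ δ₂ hδ₁ hδ₂ => ?_, hfam⟩
  obtain ⟨f₁, g, c₁, c₂, hf₁, hg, hTγ, -⟩ := hpair γ
  obtain ⟨f₁', g', c₁', c₂', hf₁', hg', hTγ', -⟩ :=
    hpair ⟨δ₁ * (γ : GL (Fin 3) L) * δ₂, mul_mem (mul_mem (Γ.isCongruence.1 hδ₁) γ.2) (Γ.isCongruence.1 hδ₂)⟩
  rw [hTγ, hTγ']
  exact transferMap_comp_pull_eq_of_mem_of_mem hHD Γ h γ.2 hδ₁ hδ₂ _ c₁ c₁' hf₁ hg hf₁' hg' 1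

end HeckeFamilyBiInvariant

section SymmetricDoubleCoset

variable {hU : BallQuotientUniformisedDatum} {h₃ : CMAbelianVarietyRealised}
variable {L : CMField} {ι₁ : L →+* ℂ} {V : HermSpace3 L ι₁}

/-- **Hecke operators of symmetric double cosets are semisimple — no commutativity input.**  For the honest Hecke
family `γ ↦ T_γ = τ'_{f₁} ∘ g^*` on `H¹(X_Γ(ℂ); ℚ)` (pairs over `Γ.heckePair γ`), every `γ` with
`γ⁻¹ ∈ Γ γ Γ` has `T_γ` semisimple: `ᵗT_γ = T_{γ⁻¹}` (`transferMap_comp_pull_eq_of_heckePair_inv`) `= T_γ`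
(`transferMap_comp_pull_eq_of_mem_of_mem`), and the family door on `S = {γ, γ⁻¹}`; with (ℓ) and (t) discharged upstream
the ONLY inputs are the level, anisotropy and the symmetry `γ⁻¹ ∈ Γ γ Γ` (classically: the basic Hecke operators at inert
primes are self-adjoint for the Petersson / Hodge–Riemann pairing).
[cite: Shimura1971, §3.1 Prop. 3.1 and §3.2–3.4] [cite: Lange2023AbelianVarietiesC, §2.4.1 Thm. 2.4.9]
[cite: VoisinHodgeI2002, §7.1.2 and §7.3.2] [cite: HatcherAT2002, §3.G p. 321] -/
theorem exists_heckeOperator_isSemisimple_of_inv_mem_doubleCoset (hHD : exists_isReal_hodgeModel)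
    (hI : hodgePQ_independent_of_hodgeModel) (Γ : Level V)
    (h : (pmsCode L ι₁ V Γ).IsAnisotropic) :
    ∃ T T' : ↥(unitaryGroup (cmConjRingHom L) V.Hm) →
        Module.End ℚ (bettiCohomology (Var.scheme hU h₃ (.pms (pmsCode L ι₁ V Γ))) 1),
      (∀ γ : ↥(unitaryGroup (cmConjRingHom L) V.Hm),
        ∃ (f₁ g : Var.scheme hU h₃ (.pms (pmsCode L ι₁ V (Γ.heckePair (γ : GL (Fin 3) L) γ.2))) ⟶
            Var.scheme hU h₃ (.pms (pmsCode L ι₁ V Γ)))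
          (c₁ : IsFiniteCover (AlgPoints.mapContinuous (L := ℂ) f₁))
          (c₂ : IsFiniteCover (AlgPoints.mapContinuous (L := ℂ) g)),
          (∀ v ∈ (Var.ballDatum hU h₃ (pmsCode L ι₁ V (Γ.heckePair (γ : GL (Fin 3) L) γ.2))
              ((isAnisotropic_pmsCode_iff_of_level Γ (Γ.heckePair (γ : GL (Fin 3) L) γ.2)).2 h)).cone,
            AlgPoints.map f₁ ((Var.ballDatum hU h₃ (pmsCode L ι₁ V (Γ.heckePair (γ : GL (Fin 3) L) γ.2))
              ((isAnisotropic_pmsCode_iff_of_level Γ (Γ.heckePair (γ : GL (Fin 3) L) γ.2)).2 h)).unif v) =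
              (Var.ballDatum hU h₃ (pmsCode L ι₁ V Γ) h).unif v) ∧
          (∀ v ∈ (Var.ballDatum hU h₃ (pmsCode L ι₁ V (Γ.heckePair (γ : GL (Fin 3) L) γ.2))
              ((isAnisotropic_pmsCode_iff_of_level Γ (Γ.heckePair (γ : GL (Fin 3) L) γ.2)).2 h)).cone,
            AlgPoints.map g ((Var.ballDatum hU h₃ (pmsCode L ι₁ V (Γ.heckePair (γ : GL (Fin 3) L) γ.2))
              ((isAnisotropic_pmsCode_iff_of_level Γ (Γ.heckePair (γ : GL (Fin 3) L) γ.2)).2 h)).unif v) =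
              (Var.ballDatum hU h₃ (pmsCode L ι₁ V Γ) h).unif
                ((((γ : GL (Fin 3) L) : Matrix (Fin 3) (Fin 3) L).map ι₁) *ᵥ v)) ∧
          T γ = (c₁.transferMap (R := ℚ) 1).hom ∘ₗ BettiUniverse.pull g 1 ∧
          T' γ = (c₂.transferMap (R := ℚ) 1).hom ∘ₗ BettiUniverse.pull f₁ 1) ∧
      (∀ γ, T γ ∈ (BettiUniverse.hodge hHD (Var.isSmoothProjective hU h₃ (.pms (pmsCode L ι₁ V Γ))) 1).endAlg) ∧
      (∀ γ, T' γ = T γ⁻¹) ∧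
      ∀ (γ : ↥(unitaryGroup (cmConjRingHom L) V.Hm)) (δ₁ δ₂ : GL (Fin 3) L), δ₁ ∈ Γ.Γ → δ₂ ∈ Γ.Γ →
        ((γ⁻¹ : ↥(unitaryGroup (cmConjRingHom L) V.Hm)) : GL (Fin 3) L) = δ₁ * (γ : GL (Fin 3) L) * δ₂ →
        (T γ).IsSemisimple := by
  obtain ⟨T, T', hpair, hT, ht, hbi, hfam⟩ :=
    exists_heckeAlgebra_isSemisimple_biInvariant (hU := hU) (h₃ := h₃) hHD hI Γ h
  refine ⟨T, T', hpair, hT, ht, fun γ δ₁ δ₂ hδ₁ hδ₂ hsym => ?_⟩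
  have hinv : T γ⁻¹ = T γ := by
    have heq : (⟨δ₁ * (γ : GL (Fin 3) L) * δ₂,
        mul_mem (mul_mem (Γ.isCongruence.1 hδ₁) γ.2) (Γ.isCongruence.1 hδ₂)⟩ :
          ↥(unitaryGroup (cmConjRingHom L) V.Hm)) = γ⁻¹ := Subtype.ext hsym.symm
    rw [← heq]
    exact hbi γ δ₁ δ₂ hδ₁ hδ₂
  have hval : ∀ δ ∈ ({γ, γ⁻¹} : Set ↥(unitaryGroup (cmConjRingHom L) V.Hm)), T δ = T γ := by
    intro δ hδ
    rcases Set.mem_insert_iff.mp hδ with rfl | hδ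
    · rfl
    · rw [Set.mem_singleton_iff.mp hδ, hinv]
  refine hfam {γ, γ⁻¹} (fun δ hδ => ?_) (fun δ hδ ε hε => ?_) (T γ)
    (Algebra.subset_adjoin ⟨⟨γ, Set.mem_insert _ _⟩, rfl⟩)
  · rcases Set.mem_insert_iff.mp hδ with rfl | hδ
    · exact Set.mem_insert_of_mem _ (Set.mem_singleton _)
    · rw [Set.mem_singleton_iff.mp hδ, inv_inv]
      exact Set.mem_insert _ _
  · rw [hval δ hδ, hval ε hε]

end SymmetricDoubleCoset

end Model

end Summit.HodgeConjecture.CorCM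

end
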